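/- Copyright: the b2b-balaban cell (near-miss cell 7), T⁴-continuum fan-out, lineage t4-ne7b-p1 (node U5c COUNT
member).  Released under the licence of the surrounding project. -/
import Summits.QuantumFields.BalabanUV.T4Continuum.Support.HistoryGenealogyExtractionR

/-!
# Genealogy extraction with per-part renewals — EVENT PRODUCTS, region counts and THE FOREST IDENTITY for `pgenR`
(H3-(ID), combinatorial half v2, repair R-40-b of F-ne7bp1g40-2; owner module of row NE7b, lineage `t4-ne7b-p1` gen 40,
ruling R-OWNER-40-3; sibling of `HistoryGenealogyExtractionR` — PRE-POSITIONING ONLY)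

Summits-side support leaf of the T⁴-continuum cell (rung (B)+1 on a FINITE torus only; NOT infinite volume, NOT the
mass gap, NOT the Clay statement; NOT a proof of the spine estimate NE7b, which is the cell's OWN estimate, NOT PRINTED
and NOT PROVED).  [folklore] finite combinatorics over `HistoryGenealogyExtractionR` (`wrapR`, `assembleR`, `pgenR`)
and row S13's `…Ledger` (`evProd`, `evProd_joinTail`, `regions_joinTail`, `sum_regions_births`, `died`,
`prod_comp_eq_continued_mul_died`); nothing printed is asserted, no `def … : Prop` fact of Bałaban's, no cite-tagged
hypothesis, zero `sorry`.  B16 = [Balaban1989LargeFieldII] pp. 383–387 under audit; locators only (C-B16-6).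

WHAT IS DEFINED AND PROVED.  `evProd_wrapR` (a renewed part carries `fR j`), `evProd_assembleR`, `regions_assembleR`,
`regions_wrapR`; `ComponentHistory.rfacs rnw fR j c` (the renewal factors of the renewed PARTS of a level-`j` component,
one `fR (j−1)` each); **`evProd_pgenR_succ`** (ONE-STEP MULTIPLICATIVITY: parts' products × `rfacs` × birth weights of
the new regions — (1.79)'s «Π′ exp(−p₀(g_j))» now attached to PARTS, so a renewed-and-merged line keeps its factor),
`evProd_pgenR_zero`, `regions_pgenR_succ`∕`_zero` (one-step additivity), **`forest_evProd_eqR`** (THE FOREST IDENTITY: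
(Π over the genealogies live at `K`) · (Π over those dead at each `j < K`) = Π_{j ≤ K} Π_{c ∈ comp j} (`rfacs` ·
birth weights) — the global re-indexing the junction M4 consumes).  Sanity: the event product of the renewed-and-merged
toy of the sibling.

HONEST.  Proves nothing of Bałaban's; BY-NAME EFFECT ON THE WALL: NONE; NE7b NOT proved; spine 0∕9.  HONEST DEPENDENCY
(cell): continuum YM on T⁴ ⇐ BetaPertH ∧ nine spine estimates (0/9 proved); BetaPertH ⇐ (D1) ∧ (D4) ∧ CAP+tail;
G-an2-4 gates asym, D1 and NE2/3/4.  This file changes none of it. -/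

open Finset
open Literature.MathematicalPhysics.QuantumFieldTheory.Balaban1983to89

namespace Summit.QuantumFields.BalabanUV.T4Continuum.HistoryGenealogyExtraction

open HistoryAdmissible HistoryAdmissible.PGen

/-! ## §3 Event products and region counts: one-step laws and the forest identity -/

section EvProdR

variable {γ : Type*} {M : Type*} [CommMonoid M] (fB : ℕ → ℕ → γ → M) (fR : ℕ → M)

/-- the event product of a wrapped part: the renewal factor `fR j` exactly when flagged [folklore] -/
theorem evProd_wrapR (rnw : ℕ → γ → Bool) (rec : γ → PGen γ) (j : ℕ) (p : γ) :
    evProd fB fR (wrapR rnw rec j p) = (if rnw j p = true then fR j else 1) * evProd fB fR (rec p) := by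
  unfold wrapR; split_ifs <;> simp

/-- the event product of an `assembleR`d genealogy with a nonempty constituent list is the product over the
constituents [folklore] -/
theorem evProd_assembleR (c : γ) (s : ℕ) :
    ∀ L : List (PGen γ), L ≠ [] → evProd fB fR (assembleR c s L) = (L.map (evProd fB fR)).prod
  | [], hL => (hL rfl).elim
  | [T], _ => by simp [assembleR]
  | T :: U :: L, _ => by simp [assembleR, evProd_joinTail]

/-- the region count of an `assembleR`d genealogy with a nonempty constituent list [folklore] -/
theorem regions_assembleR (c : γ) (s : ℕ) :
    ∀ L : List (PGen γ), L ≠ [] → (assembleR c s L).regions = (L.map PGen.regions).sum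
  | [], hL => (hL rfl).elim
  | [T], _ => by simp [assembleR]
  | T :: U :: L, _ => by simp [assembleR, regions, regions_joinTail]

/-- a wrapped part has the part's region count [folklore] -/
@[simp] theorem regions_wrapR (rnw : ℕ → γ → Bool) (rec : γ → PGen γ) (j : ℕ) (p : γ) :
    (wrapR rnw rec j p).regions = (rec p).regions := by
  unfold wrapR; split_ifs <;> simp [regions]

end EvProdR

namespace ComponentHistory

variable {γ : Type*} (H : ComponentHistory γ) (rnw : ℕ → γ → Bool)

/-- the RENEWAL FACTORS OF THE PARTS of a component `c` of level `j` (one factor `fR (j − 1)` per part renewed by the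
level-`(j − 1)` 𝐑-operation; `1` at level `0` under `WF`) [folklore] -/
def rfacs {M : Type*} [CommMonoid M] (fR : ℕ → M) (j : ℕ) (c : γ) : M :=
  ((H.parts j c).map fun p => if rnw (j - 1) p = true then fR (j - 1) else (1 : M)).prod

variable [DecidableEq γ]

/-- **ONE-STEP MULTIPLICATIVITY OF THE EVENT PRODUCT** (under `WF`, `c ∈ comp (j+1)`): parts' products × the renewal
factors of the renewed parts × the birth weights of the new regions. [folklore] -/
theorem evProd_pgenR_succ {M : Type*} [CommMonoid M] (fB : ℕ → ℕ → γ → M) (fR : ℕ → M) (hW : H.WF) (j : ℕ) (c : γ)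
    (hc : c ∈ H.comp (j + 1)) :
    evProd fB fR (H.pgenR rnw (j + 1) c) =
      H.rfacs rnw fR (j + 1) c * (((H.parts (j + 1) c).map fun p => evProd fB fR (H.pgenR rnw j p)).prod *
        ((H.news (j + 1) c).map fun n => fB (j + 1) (H.cls n) n).prod) := by
  rw [pgenR_succ_eq, evProd_assembleR fB fR c (j + 1) _ (H.constituentsR_ne_nil rnw hW _ hc),
    H.prod_map_constituentsR, ← mul_assoc]
  congr 1
  rw [rfacs, Nat.add_sub_cancel, ← List.prod_map_mul]
  exact congrArg List.prod (List.map_congr_left fun p _ => evProd_wrapR fB fR rnw _ j p)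

/-- event product at level `0` (under `WF`, `c ∈ comp 0`): the birth weights [folklore] -/
theorem evProd_pgenR_zero {M : Type*} [CommMonoid M] (fB : ℕ → ℕ → γ → M) (fR : ℕ → M) (hW : H.WF) (c : γ)
    (hc : c ∈ H.comp 0) :
    evProd fB fR (H.pgenR rnw 0 c) = ((H.news 0 c).map fun n => fB 0 (H.cls n) n).prod := by
  rw [pgenR_zero_eq, evProd_assembleR fB fR c 0 _ (H.births_zero_ne_nil hW hc), births, List.map_map]
  rfl

/-- **ONE-STEP ADDITIVITY OF THE REGION COUNT** (under `WF`, `c ∈ comp (j+1)`). [folklore] -/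
theorem regions_pgenR_succ (hW : H.WF) (j : ℕ) (c : γ) (hc : c ∈ H.comp (j + 1)) :
    (H.pgenR rnw (j + 1) c).regions =
      ((H.parts (j + 1) c).map fun p => (H.pgenR rnw j p).regions).sum + (H.news (j + 1) c).length := by
  rw [pgenR_succ_eq, regions_assembleR c (j + 1) _ (H.constituentsR_ne_nil rnw hW _ hc), H.sum_map_constituentsR,
    sum_regions_births]
  simp

/-- region count at level `0` [folklore] -/
theorem regions_pgenR_zero (hW : H.WF) (c : γ) (hc : c ∈ H.comp 0) :
    (H.pgenR rnw 0 c).regions = (H.news 0 c).length := by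
  rw [pgenR_zero_eq, regions_assembleR c 0 _ (H.births_zero_ne_nil hW hc), births, List.map_map]
  exact sum_regions_births H 0 c

/-- **THE FOREST IDENTITY** (under `WF`): (Π over the genealogies of the components live at `K`) · (Π over those that
died at each `j < K`) = Π_{j ≤ K} Π_{c ∈ comp j} (renewal factors of its renewed PARTS · birth weights of its new
regions). [folklore] -/
theorem forest_evProd_eqR {M : Type*} [CommMonoid M] (fB : ℕ → ℕ → γ → M) (fR : ℕ → M) (hW : H.WF) : ∀ K : ℕ,
    (∏ c ∈ H.comp K, evProd fB fR (H.pgenR rnw K c)) *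
        ∏ j ∈ Finset.range K, ∏ d ∈ H.died j, evProd fB fR (H.pgenR rnw j d) =
      ∏ j ∈ Finset.range (K + 1), ∏ c ∈ H.comp j,
        (H.rfacs rnw fR j c * ((H.news j c).map fun n => fB j (H.cls n) n).prod)
  | 0 => by
      rw [Finset.prod_range_zero, mul_one, Finset.prod_range_one]
      refine Finset.prod_congr rfl fun c hc => ?_
      have h0 : H.rfacs rnw fR 0 c = 1 := by simp [rfacs, hW.parts_zero c]
      rw [h0, one_mul, H.evProd_pgenR_zero rnw fB fR hW c hc]
  | K + 1 => by
      have ih := forest_evProd_eqR fB fR hW K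
      have hstep : ∏ c ∈ H.comp (K + 1), evProd fB fR (H.pgenR rnw (K + 1) c) =
          (∏ c ∈ H.comp (K + 1), (H.rfacs rnw fR (K + 1) c *
              ((H.news (K + 1) c).map fun n => fB (K + 1) (H.cls n) n).prod)) *
            ∏ c ∈ H.comp (K + 1), ((H.parts (K + 1) c).map fun p => evProd fB fR (H.pgenR rnw K p)).prod := by
        rw [← Finset.prod_mul_distrib]
        refine Finset.prod_congr rfl fun c hc => ?_
        rw [H.evProd_pgenR_succ rnw fB fR hW K c hc]
        ac_rfl
      have htel := H.prod_comp_eq_continued_mul_died hW K (fun a => evProd fB fR (H.pgenR rnw K a))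
      rw [Finset.prod_range_succ _ (K + 1), Finset.prod_range_succ _ K, hstep, ← ih, htel]
      ac_rfl

end ComponentHistory

/-! ## Sanity: the event product of the renewed-and-merged toy -/

namespace SanityR

/-- birth weights `10^class`, renewal weight `7`: the genealogy `join (renew (birth 0 1 1) 0) (birth 1 0 7) 1` of the
sibling's `toyRM` weighs `7 · 10 · 1 = 70` — the renewal factor is KEPT through the merger [folklore] -/
example : evProd (fun _ d _ => (10 : ℕ) ^ d) (fun _ => 7) (toyRM.pgenR rnwToy 1 5) = 70 := by decide

/-- row S13's extraction of the same data weighs `10` (renewal dropped) [folklore] -/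
example : evProd (fun _ d _ => (10 : ℕ) ^ d) (fun _ => 7) (toyRM.pgen 1 5) = 10 := by decide

end SanityR

end Summit.QuantumFields.BalabanUV.T4Continuum.HistoryGenealogyExtraction
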